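/-
Copyright (c) 2026. All rights reserved.
Released under Apache 2.0 license as described in the file LICENSE.
Authors: abc-iut cell, seat abc-iut-L4-t5 (gen 4; block W2-B1, [AbsTopIII] Cor 3.6 at the model).
-/
import Literature.AnabelianGeometry.AbsoluteAnabelian.AbsTopIII.FrobeniusPictureMLFModel
import HarnessLib

/-!
# [AbsTopIII] Corollary 3.6 (iii), second clause, AT THE MODEL: `ι_×`, `ι_{log,⋎}` lie over the
# identity of `ℰ` (`IotaOverGaloisStmt` proved for the model data)

S. Mochizuki, *Topics in absolute anabelian geometry III* [MochizukiAbsTopIII2015] (kurims manuscript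
`paper:url-5493eb38cbb7`), Cor 3.6 (iii) p. 80 and its proof p. 81: "it is immediate from the
definitions — i.e., in essence, because the various Galois groups that appear remain 'undisturbed' by
the various manipulations involving arithmetic data that arise from '`ι_{log,⋎}`', '`ι_×`' — that this
family of homotopies is compatible with the families of homotopies that constitute the core and
telecore structures".

Proof-only companion of `FrobeniusPictureMLFModel.lean` (abc-iut-L4-t5): for the model data
`TFModel.monoAnabelianData I` (abc-iut-L4-t9's model `λ^×`, `λ^{×pf}`, `ι_×`, `ι_log` restricted to a
type `P`, `log = 𝟭`) the typed content of Cor 3.6 (iii)'s second clause,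
`LogFrobeniusData.IotaOverGaloisStmt` (`FrobeniusPictureMLFTelecore.lean`; the cell's fact-list entry
F-0360, parametrised), HOLDS: the Galois components of `ι_×` and `ι_log` are identities BY CONSTRUCTION
(`TFModel.iotaTimes` / `TFModel.iotaLog` have `φ_Π = id`), and `log ≅ 𝟭` is the identity.

HONEST FRAMING: refereed pre-IUT material; a kernel verification on the cell's model; nothing here
bears on [IUTchIII] Cor. 3.12; typed ≠ discharged except for the theorems of this file.
-/

set_option autoImplicit false

noncomputable section

namespace Literature.AnabelianGeometry.AbsoluteAnabelian.AbsTopIII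

open CategoryTheory

namespace TFModel

variable {p : ℕ} [Fact p.Prime] {P : ObjectProperty (TFModel p)} {D : Type 1} [Category.{1} D]

/-- A morphism between (propositionally) equal objects that is heterogeneously the identity is the
`eqToHom` (bookkeeping for functor equalities "on the nose"). [cite: MochizukiAbsTopIII2015, Corollary 3.6 (iii) p.81] -/
private theorem eq_eqToHom_of_heq_id {C : Type*} [Category C] {a b : C} (h : a = b) (f : a ⟶ b)
    (hf : HEq f (𝟙 a)) : f = eqToHom h := by
  cases h
  simpa using hf

/-- `f = eqToHom ≫ m ≫ eqToHom` for morphisms between (propositionally) equal objects that are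
heterogeneously identities (bookkeeping for the `ι_log` clause, whose right-hand side passes through
`log ≅ 𝟭`). [cite: MochizukiAbsTopIII2015, Corollary 3.6 (iii) p.81] -/
private theorem eq_eqToHom_comp_of_heq_id {C : Type*} [Category C] {a b c d : C} (h₁ : a = b)
    (h₃ : b = c) (h₂ : c = d) (f : a ⟶ d) (m : b ⟶ c) (hm : HEq m (𝟙 b)) (hf : HEq f (𝟙 a)) :
    f = eqToHom h₁ ≫ m ≫ eqToHom h₂ := by
  cases h₁
  cases h₃
  cases h₂
  simp only [heq_eq_eq] at hm hf
  subst hm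
  subst hf
  simp

/-- At the model, `(𝒩_P → ℰ)(ι_{×,x})` is the identity of the Galois group `Π_x` (the Galois component of
abc-iut-L4-t9's `ι_×` is `id`). [cite: MochizukiAbsTopIII2015, Corollary 3.6 (iii) p.81] -/
theorem spaceToGalImage_map_iotaTimesP (x : P.FullSubcategory) :
    (spaceToGalImage p P).map ((iotaTimesP p P).app x) = 𝟙 ((lamTimesP p P ⋙ spaceToGalImage p P).obj x) :=
  ObjectProperty.hom_ext _ (TopGroupObj.Hom.ext fun _ => rfl)

/-- At the model, `(𝒩_P → ℰ)(ι_{log,x})` is the identity of the Galois group `Π_x` (the Galois component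
of abc-iut-L4-t9's `ι_log` is `id`). [cite: MochizukiAbsTopIII2015, Corollary 3.6 (iii) p.81] -/
theorem spaceToGalImage_map_iotaLogP (x : P.FullSubcategory) :
    (spaceToGalImage p P).map ((iotaLogP p P).app x) =
      𝟙 ((𝟭 _ ⋙ lamTimesP p P ⋙ spaceToGalImage p P).obj x) :=
  ObjectProperty.hom_ext _ (TopGroupObj.Hom.ext fun _ => rfl)

/-- **[AbsTopIII] Cor 3.6 (iii), second clause, AT THE MODEL** — the typed content
`IotaOverGaloisStmt` ("`ι_×`, `ι_{log,⋎}` lie over the identity of `ℰ`": after `𝒩 → ℰ` the component of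
`ι_×` at `x` is the identity of `(𝒳 → ℰ)(x)` through `λ^× ⋙ (𝒩 → ℰ) = (𝒳 → ℰ) = λ^{×pf} ⋙ (𝒩 → ℰ)`, and
that of `ι_{log,⋎}` is the isomorphism induced by `log ≅ 𝟭`) HOLDS for the model data of every type `P`
and every Cor-1.10 datum `I` — "the various Galois groups that appear remain 'undisturbed'" is TRUE BY
CONSTRUCTION of the model functors. [cite: MochizukiAbsTopIII2015, Corollary 3.6 (iii) p.81] -/
theorem iotaOverGaloisStmt_model (I : AnabelianInput p P D) :
    (monoAnabelianData I).toLogFrobeniusData.IotaOverGaloisStmt := by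
  constructor
  · intro x
    exact eq_eqToHom_of_heq_id _ _ (heq_of_eq (spaceToGalImage_map_iotaTimesP x))
  · intro x
    exact eq_eqToHom_comp_of_heq_id _ rfl _ _ _ (heq_of_eq ((toGalImage p P).map_id x))
      (heq_of_eq (spaceToGalImage_map_iotaLogP x))

end TFModel

end Literature.AnabelianGeometry.AbsoluteAnabelian.AbsTopIII

end
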